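import Mathlib.Analysis.SpecialFunctions.Integrals.Basic
import Mathlib.Analysis.SpecialFunctions.Trigonometric.Deriv
import HarnessLib

/-!
# Route `BECTangentRigidity`, crux `RigidMomentumBound` (stmt-AtomisticToContinuum-13034):
# stub `stub_smearWeight` — elementary facts about the rigid-smearing weight

The smearing step of the registered line averages `|Φ|²` over rigid translations `t ∈ [0, 2τ]`
with the weight `w(t) = τ⁻¹ sin²(πt/(2τ))`. This file proves the four elementary facts about `w`
used there, for every `τ > 0`:

1. `∫₀^{2τ} w = 1`;
2. with `u(t) = (π²/τ³) cos²(πt/(2τ))`, `∫₀^{2τ} u = π²/τ²`;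
3. `w'(t)² = w(t) · u(t)` pointwise, where `w'(t) = (π/(2τ²)) sin(πt/τ)` (double-angle formula);
4. `HasDerivAt w (w' t) t` (chain rule).

Both integrals reduce, after the substitution `x = πt/(2τ)`
(`intervalIntegral.integral_comp_mul_left`), to `∫₀^π sin² = ∫₀^π cos² = π/2`
(`integral_sin_sq`, `integral_cos_sq`).
-/

noncomputable section

namespace Summit.AtomisticToContinuum.BoseEinsteinCondensation.Theorems.RigidMomentumBound

open MeasureTheory intervalIntegral
open scoped Real

/-- `∫₀^{2τ} sin²(πt/(2τ)) dt = τ` for `τ > 0` (substitute `x = πt/(2τ)` and use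
`∫₀^π sin² = π/2`). [folklore] -/
theorem integral_sin_sq_smear {τ : ℝ} (hτ : 0 < τ) :
    ∫ t in (0 : ℝ)..(2 * τ), Real.sin (π * t / (2 * τ)) ^ 2 = τ := by
  -- adapted from Literature/Geometry/Riemannian/DistanceDirectionalData.lean (`integral_cos_sq_profile`)
  have hc : π / (2 * τ) ≠ 0 := by positivity
  have h1 : (fun t ↦ Real.sin (π * t / (2 * τ)) ^ 2) =
      fun t ↦ (fun x ↦ Real.sin x ^ 2) (π / (2 * τ) * t) := by
    funext t; congr 2; ring
  rw [h1, intervalIntegral.integral_comp_mul_left (fun x ↦ Real.sin x ^ 2) hc, integral_sin_sq]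
  have e : π / (2 * τ) * (2 * τ) = π := by field_simp
  simp only [mul_zero, Real.sin_zero, e, Real.sin_pi, zero_mul, sub_zero, zero_add, smul_eq_mul]
  field_simp

/-- `∫₀^{2τ} cos²(πt/(2τ)) dt = τ` for `τ > 0` (substitute `x = πt/(2τ)` and use
`∫₀^π cos² = π/2`). [folklore] -/
theorem integral_cos_sq_smear {τ : ℝ} (hτ : 0 < τ) :
    ∫ t in (0 : ℝ)..(2 * τ), Real.cos (π * t / (2 * τ)) ^ 2 = τ := by
  -- adapted from Literature/Geometry/Riemannian/DistanceDirectionalData.lean (`integral_cos_sq_profile`)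
  have hc : π / (2 * τ) ≠ 0 := by positivity
  have h1 : (fun t ↦ Real.cos (π * t / (2 * τ)) ^ 2) =
      fun t ↦ (fun x ↦ Real.cos x ^ 2) (π / (2 * τ) * t) := by
    funext t; congr 2; ring
  rw [h1, intervalIntegral.integral_comp_mul_left (fun x ↦ Real.cos x ^ 2) hc, integral_cos_sq]
  have e : π / (2 * τ) * (2 * τ) = π := by field_simp
  simp only [mul_zero, Real.sin_zero, e, Real.sin_pi, sub_zero, zero_add, smul_eq_mul]
  field_simp

/-- Double angle in the smearing variables: `sin(πt/τ) = 2 sin(πt/(2τ)) cos(πt/(2τ))`.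
[folklore] -/
theorem sin_smear_two_mul (τ t : ℝ) :
    Real.sin (π * t / τ) = 2 * Real.sin (π * t / (2 * τ)) * Real.cos (π * t / (2 * τ)) := by
  rw [← Real.sin_two_mul]
  congr 1
  ring

/-- The smearing weight `w(t) = τ⁻¹ sin²(πt/(2τ))` has derivative
`w'(t) = (π/(2τ²)) sin(πt/τ)` (chain rule and the double-angle formula). [folklore] -/
theorem hasDerivAt_smearWeight (τ t : ℝ) :
    HasDerivAt (fun t : ℝ => τ⁻¹ * Real.sin (π * t / (2 * τ)) ^ 2)
      (π / (2 * τ ^ 2) * Real.sin (π * t / τ)) t := by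
  have h1 : HasDerivAt (fun t : ℝ => π * t / (2 * τ)) (π * 1 / (2 * τ)) t :=
    ((hasDerivAt_id t).const_mul π).div_const (2 * τ)
  have h2 : HasDerivAt (fun t : ℝ => Real.sin (π * t / (2 * τ)))
      (Real.cos (π * t / (2 * τ)) * (π * 1 / (2 * τ))) t :=
    (Real.hasDerivAt_sin _).comp t h1
  refine ((h2.fun_pow 2).const_mul τ⁻¹).congr_deriv ?_
  rw [sin_smear_two_mul τ t, show (2 - 1 : ℕ) = 1 from rfl, pow_one, Nat.cast_ofNat]
  ring

/-- **`stub_smearWeight`** (elementary): the smearing weight `w(t) = τ⁻¹ sin²(πt/(2τ))` on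
`[0, 2τ]` has mass `1`, derivative `w'(t) = (π/(2τ²)) sin(πt/τ)`, and `w'² = w·u` with
`u(t) = (π²/τ³) cos²(πt/(2τ))` of mass `∫₀^{2τ} u = π²/τ²` (so the Fisher information `∫w'²/w`
of `w` is `π²/τ²`). [folklore] -/
theorem stub_smearWeight :
    ∀ τ : ℝ, 0 < τ →
      (∫ t in (0 : ℝ)..(2 * τ), τ⁻¹ * Real.sin (Real.pi * t / (2 * τ)) ^ 2) = 1 ∧
      (∫ t in (0 : ℝ)..(2 * τ), Real.pi ^ 2 / τ ^ 3 * Real.cos (Real.pi * t / (2 * τ)) ^ 2) =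
          Real.pi ^ 2 / τ ^ 2 ∧
      (∀ t : ℝ, (Real.pi / (2 * τ ^ 2) * Real.sin (Real.pi * t / τ)) ^ 2 =
          (τ⁻¹ * Real.sin (Real.pi * t / (2 * τ)) ^ 2) *
            (Real.pi ^ 2 / τ ^ 3 * Real.cos (Real.pi * t / (2 * τ)) ^ 2)) ∧
      (∀ t : ℝ, HasDerivAt (fun t : ℝ => τ⁻¹ * Real.sin (Real.pi * t / (2 * τ)) ^ 2)
          (Real.pi / (2 * τ ^ 2) * Real.sin (Real.pi * t / τ)) t) := by
  intro τ hτ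
  have hτ0 : τ ≠ 0 := hτ.ne'
  refine ⟨?_, ?_, ?_, hasDerivAt_smearWeight τ⟩
  · rw [intervalIntegral.integral_const_mul, integral_sin_sq_smear hτ, inv_mul_cancel₀ hτ0]
  · rw [intervalIntegral.integral_const_mul, integral_cos_sq_smear hτ]
    field_simp
  · intro t
    rw [sin_smear_two_mul τ t]
    ring

end Summit.AtomisticToContinuum.BoseEinsteinCondensation.Theorems.RigidMomentumBound

end
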